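import Mathlib
import Literature.Analysis.FluidPDE.VectorCalculus
import Summits.NavierStokesRegularity.NavierStokesRegularity.Theorems.FilamentSkeletonRssSelectionBoxRJRungSlipLaw
import Summits.NavierStokesRegularity.NavierStokesRegularity.Theorems.FilamentSkeletonRssSkeletonEquilibriumBiotSavartDifferentiable

/-!
# Route `FilamentSkeletonRss` · crux `SelectionBoxRJ` (stmt-NavierStokesRegularity-21220) — rung tools:
# the true-box ZONE LEMMA for clause 11 (unique stagnation zero away from the strain zone)

Lane `ns-filament-19175-p1` (g6); assembles the memo `SIGMA-SCALING-21220.md` §4 at the level of the route's own objects.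
Helper file `--supports stmt-NavierStokesRegularity-21220`.

For a box datum — filaments `X_k` (`C¹`, `‖X_k′‖ ≤ 1`, linear growth, so that every regularised Biot–Savart field
`F_k(y) = ∫ K₃(y − X_k u) • X_k′(u) × (y − X_k u) du` is differentiable, `stub_biotSavartDifferentiable`), the skeleton
field `u = Σ_k c_k F_k` (hypothesis `hu` of the box with `c_k = Γγ_k/4π`, core `e = 1`), a `C²` unit-speed filament
`X = X_j` with differentiable tangential speed `w` (clause 2) and exact tangency `u(X τ) + V(X τ) = w τ X′ τ` on an OPEN
parameter set `S` (clause 7 on the interior of the tangency ball; `V y = ½y − α e₃×y`):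

* `box_slip_deriv_eq_fieldStrain` — on `S`, `w′ τ = ½ + Σ_k c_k ⟪DF_k(X τ) X′ τ, X′ τ⟫`: the stretching identity
  (`box_slip_deriv`, p575830) with the induced velocity identified as the FIELD `u` along the filament and
  differentiated by the chain rule — the slip derivative is `½` plus the sum of the axial strains of the individual
  filament fields (partners AND self).
* `box_zone_strictMonoOn`, `box_zone_zero_unique` — consequently, on every convex `D ⊆ S` along which
  `Σ_k c_k ⟪DF_k(X τ) X′ τ, X′ τ⟫ > −½`, `w` is strictly increasing and has at most one zero.  The companion files bound
  each axial strain explicitly and `Γ`-uniformly in waist units: partners by `biotSavart_axialStrain_le`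
  (`≤ 8π(D + A)/(cD³)`, p577644), the filament's own field by `self_axialStrain_le`
  (`≤ 6θ/(c⁴δ²) + 2δ(3/c⁴)((3/2)κ₀H + H²δ)`, p579910) — so clause 11 can only fail inside the `Γ`-independent zone
  where the partner strain reaches `½ − O(Rb² + 1/log Γ)`, where rung 0 (p569595) controls `w`.

HONEST FRAMING.  Bookkeeping for the rung ladder of a HYPOTHETICAL filament box; nothing here is a claim about
Navier–Stokes regularity or blow-up.
-/

set_option linter.dupNamespace false

noncomputable section

namespace Summit.NavierStokesRegularity.NavierStokesRegularity.Theorems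

open Set Function Filter MeasureTheory Real
open Literature.Analysis.FluidPDE
open Summit.NavierStokesRegularity.NavierStokesRegularity.Theorems.SkeletonEquilibrium.Sketch
open scoped InnerProductSpace Topology

namespace SelectionBoxRJRung

/-- **Slip derivative = ½ + sum of axial field strains.**  See the module docstring. [folklore] -/
theorem box_slip_deriv_eq_fieldStrain {N : ℕ} {e c₀ α : ℝ} {C : Fin N → ℝ} {coef : Fin N → ℝ}
    {Xs : Fin N → ℝ → EuclideanSpace ℝ (Fin 3)} (he : e ≠ 0) (hc₀ : 0 < c₀) (hXs : ∀ k, ContDiff ℝ 1 (Xs k))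
    (hdXs : ∀ k u, ‖deriv (Xs k) u‖ ≤ 1) (hgrow : ∀ k u, c₀ * |u| - C k ≤ ‖Xs k u‖)
    {X : ℝ → EuclideanSpace ℝ (Fin 3)} {w : ℝ → ℝ} (hX : ContDiff ℝ 2 X) (hunit : ∀ τ, ‖deriv X τ‖ = 1)
    (hw : Differentiable ℝ w) {S : Set ℝ} (hS : IsOpen S)
    (htan : ∀ τ ∈ S, (∑ k, coef k • ∫ u : ℝ, ((‖X τ - Xs k u‖ ^ 2 + e ^ 2) ^ (3 / 2 : ℝ))⁻¹ •
        cross (deriv (Xs k) u) (X τ - Xs k u)) +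
        ((1 / 2 : ℝ) • X τ - α • cross (EuclideanSpace.single 2 1) (X τ)) = w τ • deriv X τ)
    {τ : ℝ} (hτ : τ ∈ S) :
    deriv w τ = 1 / 2 + ∑ k, coef k * ⟪fderiv ℝ (fun y : EuclideanSpace ℝ (Fin 3) => ∫ u : ℝ,
        ((‖y - Xs k u‖ ^ 2 + e ^ 2) ^ (3 / 2 : ℝ))⁻¹ • cross (deriv (Xs k) u) (y - Xs k u)) (X τ) (deriv X τ),
        deriv X τ⟫_ℝ := by
  set F : Fin N → EuclideanSpace ℝ (Fin 3) → EuclideanSpace ℝ (Fin 3) := fun k y =>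
    ∫ u : ℝ, ((‖y - Xs k u‖ ^ 2 + e ^ 2) ^ (3 / 2 : ℝ))⁻¹ • cross (deriv (Xs k) u) (y - Xs k u) with hF
  set ufield : EuclideanSpace ℝ (Fin 3) → EuclideanSpace ℝ (Fin 3) := fun y => ∑ k, coef k • F k y with hufield
  have hXd : Differentiable ℝ X := hX.differentiable (by norm_num)
  have hFd : ∀ k, Differentiable ℝ (F k) := fun k =>
    stub_biotSavartDifferentiable e c₀ (C k) (Xs k) he hc₀ (hXs k) (hdXs k) (hgrow k)
  -- chain rule for `ufield ∘ X` at `τ`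
  have hud : HasFDerivAt ufield (∑ k, coef k • fderiv ℝ (F k) (X τ)) (X τ) :=
    HasFDerivAt.fun_sum fun k _ => ((hFd k (X τ)).hasFDerivAt).const_smul (coef k)
  have hcomp : HasDerivAt (fun σ => ufield (X σ)) ((∑ k, coef k • fderiv ℝ (F k) (X τ)) (deriv X τ)) τ :=
    hud.comp_hasDerivAt τ (hXd τ).hasDerivAt
  -- on `S` the field along the filament equals `w X′ − V(X)`
  have hEq : (fun σ => w σ • deriv X σ - ((1 / 2 : ℝ) • X σ - α • cross (EuclideanSpace.single 2 1) (X σ)))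
      =ᶠ[𝓝 τ] fun σ => ufield (X σ) := by
    filter_upwards [hS.mem_nhds hτ] with σ hσ
    have h := htan σ hσ
    simp only [hufield, hF]
    rw [← h]
    abel
  have hderiv : deriv (fun σ => w σ • deriv X σ -
      ((1 / 2 : ℝ) • X σ - α • cross (EuclideanSpace.single 2 1) (X σ))) τ =
      (∑ k, coef k • fderiv ℝ (F k) (X τ)) (deriv X τ) := by
    rw [hEq.deriv_eq]
    exact hcomp.deriv
  rw [box_slip_deriv (α := α) hX hunit hw τ, hderiv]
  congr 1
  have happly : (∑ k, coef k • fderiv ℝ (F k) (X τ)) (deriv X τ) = ∑ k, coef k • fderiv ℝ (F k) (X τ) (deriv X τ) := by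
    simp
  rw [happly, sum_inner]
  refine Finset.sum_congr rfl fun k _ => ?_
  rw [real_inner_smul_left]

/-- **Zone lemma (monotone form).**  Under the hypotheses of `box_slip_deriv_eq_fieldStrain`, on any convex `D ⊆ S`
along which the total axial field strain exceeds `−½`, the tangential speed `w` is strictly increasing. [folklore] -/
theorem box_zone_strictMonoOn {N : ℕ} {e c₀ α : ℝ} {C : Fin N → ℝ} {coef : Fin N → ℝ}
    {Xs : Fin N → ℝ → EuclideanSpace ℝ (Fin 3)} (he : e ≠ 0) (hc₀ : 0 < c₀) (hXs : ∀ k, ContDiff ℝ 1 (Xs k))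
    (hdXs : ∀ k u, ‖deriv (Xs k) u‖ ≤ 1) (hgrow : ∀ k u, c₀ * |u| - C k ≤ ‖Xs k u‖)
    {X : ℝ → EuclideanSpace ℝ (Fin 3)} {w : ℝ → ℝ} (hX : ContDiff ℝ 2 X) (hunit : ∀ τ, ‖deriv X τ‖ = 1)
    (hw : Differentiable ℝ w) {S : Set ℝ} (hS : IsOpen S)
    (htan : ∀ τ ∈ S, (∑ k, coef k • ∫ u : ℝ, ((‖X τ - Xs k u‖ ^ 2 + e ^ 2) ^ (3 / 2 : ℝ))⁻¹ •
        cross (deriv (Xs k) u) (X τ - Xs k u)) +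
        ((1 / 2 : ℝ) • X τ - α • cross (EuclideanSpace.single 2 1) (X τ)) = w τ • deriv X τ)
    {D : Set ℝ} (hD : Convex ℝ D) (hDS : D ⊆ S)
    (hstrain : ∀ τ ∈ D, -(1 / 2 : ℝ) < ∑ k, coef k * ⟪fderiv ℝ (fun y : EuclideanSpace ℝ (Fin 3) => ∫ u : ℝ,
        ((‖y - Xs k u‖ ^ 2 + e ^ 2) ^ (3 / 2 : ℝ))⁻¹ • cross (deriv (Xs k) u) (y - Xs k u)) (X τ) (deriv X τ),
        deriv X τ⟫_ℝ) :
    StrictMonoOn w D := by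
  refine strictMonoOn_of_hasDerivAt_pos hD (fun τ _ => (hw τ).hasDerivAt) fun τ hτ => ?_
  rw [box_slip_deriv_eq_fieldStrain he hc₀ hXs hdXs hgrow hX hunit hw hS htan (hDS hτ)]
  linarith [hstrain τ hτ]

/-- **Zone lemma (clause-11 form).**  Under the same hypotheses any two zeros of `w` in `D` coincide. [folklore] -/
theorem box_zone_zero_unique {N : ℕ} {e c₀ α : ℝ} {C : Fin N → ℝ} {coef : Fin N → ℝ}
    {Xs : Fin N → ℝ → EuclideanSpace ℝ (Fin 3)} (he : e ≠ 0) (hc₀ : 0 < c₀) (hXs : ∀ k, ContDiff ℝ 1 (Xs k))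
    (hdXs : ∀ k u, ‖deriv (Xs k) u‖ ≤ 1) (hgrow : ∀ k u, c₀ * |u| - C k ≤ ‖Xs k u‖)
    {X : ℝ → EuclideanSpace ℝ (Fin 3)} {w : ℝ → ℝ} (hX : ContDiff ℝ 2 X) (hunit : ∀ τ, ‖deriv X τ‖ = 1)
    (hw : Differentiable ℝ w) {S : Set ℝ} (hS : IsOpen S)
    (htan : ∀ τ ∈ S, (∑ k, coef k • ∫ u : ℝ, ((‖X τ - Xs k u‖ ^ 2 + e ^ 2) ^ (3 / 2 : ℝ))⁻¹ •
        cross (deriv (Xs k) u) (X τ - Xs k u)) +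
        ((1 / 2 : ℝ) • X τ - α • cross (EuclideanSpace.single 2 1) (X τ)) = w τ • deriv X τ)
    {D : Set ℝ} (hD : Convex ℝ D) (hDS : D ⊆ S)
    (hstrain : ∀ τ ∈ D, -(1 / 2 : ℝ) < ∑ k, coef k * ⟪fderiv ℝ (fun y : EuclideanSpace ℝ (Fin 3) => ∫ u : ℝ,
        ((‖y - Xs k u‖ ^ 2 + e ^ 2) ^ (3 / 2 : ℝ))⁻¹ • cross (deriv (Xs k) u) (y - Xs k u)) (X τ) (deriv X τ),
        deriv X τ⟫_ℝ)
    {a b : ℝ} (ha : a ∈ D) (hb : b ∈ D) (hwa : w a = 0) (hwb : w b = 0) : a = b :=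
  zero_unique_of_strictMonoOn (box_zone_strictMonoOn he hc₀ hXs hdXs hgrow hX hunit hw hS htan hD hDS hstrain)
    ha hb hwa hwb

end SelectionBoxRJRung

end Summit.NavierStokesRegularity.NavierStokesRegularity.Theorems
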